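import Literature.AlgebraicGeometry.GroupSchemes.DiagonalizableKilledByFrobenius
import Literature.AlgebraicGeometry.GroupSchemes.CartierDualPointsGroupLike
import Literature.AlgebraicGeometry.GroupSchemes.EtaleOfTrivialUnitComponent
import HarnessLib

/-!
# A finite commutative group scheme with étale Cartier dual (over `k = k̄`) is diagonalizable: its algebra has a basis of group-like elements
# (Tate 1997 (3.7); Demazure 1972 II §8), hence is killed by `F^t` when killed by `p^t`

Topic `Literature/AlgebraicGeometry/GroupSchemes`; namespaces `Literature.AlgebraicGeometry.GroupSchemes.AffineGroupScheme` (§1–§2) and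
`Literature.AlgebraicGeometry.GroupSchemes` (§3).  THEOREMS ONLY (no definition, no instance, no notation, no named fact, no `sorry`).  Cell
`hodgecm-mathlib` (D-0151), programme P6 «MOD» (crux hLiu418 = stmt-HodgeConjecture-24832, `--supports`, count-neutral): part (i) «`G^D` étale ⇒ `G`
multiplicative = dual of a constant group» of organ (O-δ) «MULT-BLOCK ∕ FROB₀-UNIT» (P6a desk F0P6a-plan (g1) ORGAN DEALS #1, 2026-09-01; lead hand B-p17
(g27), this part B-p04 (g38)); sequel of ★ `DiagonalizableKilledByFrobenius`.  HC_CM is proved only modulo the printed citations until rung 0 closes; this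
file is generic and changes no count.

THE PRINT.  [Tate1997FiniteFlatGroupSchemes] (3.7), §(3.8) p. 145: the `k`-points of `G^D` are the group-like elements of `Γ(G) ⊗ k = Γ(G)`
(`G^D(k) = Hom(G, 𝔾_m)`), and over `k = k̄` a finite étale `k`-scheme has as many points as its rank; [Demazure1972] Ch. II §8: `G` is
DIAGONALIZABLE (`≅ D(M) = Spec k[M]`) iff the group-like elements (characters) span `Γ(G)`, and over `k = k̄` «multiplicative = diagonalizable =
dual of constant».  HERE, for a finite commutative affine group scheme `G` over a field `k`: the group-like elements of `Γ(G)` are `k`-linearly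
independent (Mathlib `linearIndep_groupLikeVal`) and finite in number; they are in bijection with the `k`-points of `G^D` (★
`cartierDualPointsMulEquivGroupLike` + Mathlib `Bialgebra.TensorProduct.lid`); so if `k = k̄` and `G^D` is ÉTALE their number is `rk Γ(G^D) = rk Γ(G)`
(★ `natCard_hom_eq_finrank_of_etale`, ★ `finrank_alg_cartierDual`) and they form a BASIS of `Γ(G)`; with ★ `DiagonalizableKilledByFrobenius` §5,
`(𝟙 G)^{p^t} = 1 ⟹ F^t_{G∕k} = 1`.

* §1 `finite_groupLike`, `natCard_groupLike_eq_natCard_hom_cartierDual` (`#GroupLike k Γ(G) = #G^D(Spec k)`, any field),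
  **`natCard_groupLike_eq_finrank`** (`= rk Γ(G)` for `G^D` étale, `k = k̄`).
* §2 **`span_isGroupLikeElem_eq_top_of_etale_cartierDual`**, **`exists_basis_groupLike_of_etale_cartierDual`** (`G` IS DIAGONALIZABLE).
* §3 HEAD **`relFrobeniusOver_eq_one_of_etale_cartierDual_of_id_pow_eq_one`** («MULTIPLICATIVE + killed by `p^t` ⇒ killed by `F^t`») and its
  `c ≫ F^t_{G∕k} = 1` form for unit-preserving `c : H → G` out of such an `H`.

NOT here: the converse (diagonalizable ⇒ `G^D` étale ∕ constant), the isomorphism `G ≅ (G^D(k))^D_{const}` as group schemes (the basis statement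
is its honest content for the P6 consumer), «`G(k̄) = 1`» (not needed).

## References
* [Tate1997FiniteFlatGroupSchemes] J. Tate, *Finite flat group schemes* (1997), (3.7), §(3.8) p. 145.
* [Demazure1972] M. Demazure, *Lectures on p-divisible groups*, LNM 302 (1972), Ch. II §8, Ch. III §6.
* [SGA3I] M. Demazure, A. Grothendieck (eds.), *SGA 3, Tome I*, Exp. VII_A (P. Gabriel), 4.1.
* [GortzWedhorn2023] U. Görtz, T. Wedhorn, *Algebraic Geometry II* (2023), §(27.2) (p. 606).
-/

set_option autoImplicit false

noncomputable section

open CategoryTheory CategoryTheory.Limits AlgebraicGeometry MonoidalCategory CartesianMonoidalCategory WithConv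

open scoped MonObj CategoryTheory.Obj

universe u

namespace Literature.AlgebraicGeometry.GroupSchemes

namespace AffineGroupScheme

open Literature.AlgebraicGeometry.Motives Literature.NumberTheory.DiophantineGeometry Literature.RingTheory.HopfAlgebra

variable {k : Type u} [Field k] (G : SchemeOver k) [GrpObj G] [IsCommMonObj G] [IsAffine G.left] [Module.Finite k (Alg G)]

/-! ## §1 Counting group-like elements: `#GroupLike k Γ(G) = #G^D(k)` -/

omit [IsCommMonObj G] in
/-- The group-like elements of `Γ(G)` are FINITE in number (linearly independent — Mathlib `linearIndep_groupLikeVal` — in a finite-dimensional space).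
[cite: Demazure1972, Ch. II §8] -/
theorem finite_groupLike : Finite (GroupLike k (Alg G)) :=
  (linearIndep_groupLikeVal (R := k) (A := Alg G)).finite_of_isNoetherian

/-- **`#GroupLike k Γ(G) = #G^D(Spec k)`** (any field `k`): the `k`-points of `G^D` are the group-like elements of `k ⊗_k Γ(G)` (★
`cartierDualPointsMulEquivGroupLike`, Tate's «`G^D(S)` = group-likes of `A ⊗ S`»), and `k ⊗_k Γ(G) ≃ Γ(G)` as bialgebras (Mathlib `Bialgebra.TensorProduct.lid`)
preserves group-likes. [cite: Tate1997FiniteFlatGroupSchemes, §(3.8) p. 145] -/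
theorem natCard_groupLike_eq_natCard_hom_cartierDual :
    Nat.card (GroupLike k (Alg G)) = Nat.card (Motives.specOver k k ⟶ cartierDual G) := by
  let L := Bialgebra.TensorProduct.lid k (Alg G)
  let e1 : GroupLike k (TensorProduct k k (Alg G)) ≃ GroupLike k (Alg G) :=
    { toFun := fun g => ⟨L g.val, g.isGroupLikeElem_val.map L⟩
      invFun := fun g => ⟨L.symm g.val, g.isGroupLikeElem_val.map L.symm⟩
      left_inv := fun g => GroupLike.ext (L.symm_apply_apply g.val)
      right_inv := fun g => GroupLike.ext (L.apply_symm_apply g.val) }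
  exact (Nat.card_congr ((cartierDualPointsMulEquivGroupLike k G).toEquiv.trans e1)).symm

omit [GrpObj G] [IsCommMonObj G] [IsAffine G.left] [Module.Finite k (Alg G)] in
set_option backward.isDefEq.respectTransparency false in
/-- `Spec k → Spec k` (the `k`-algebra `k`) IS the monoidal unit of `SchemeOver k` (`algebraMap k k = id`; the shape of ★ `Motives.specOverSelfIso`, which lives in a
projective-space file not imported here). [cite: GortzWedhorn2023, §(27.2) (p. 606)] -/
private theorem nonempty_iso_specOver_self_tensorUnit : Nonempty (Motives.specOver k k ≅ 𝟙_ (SchemeOver k)) :=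
  ⟨Over.isoMk (Iso.refl _) (by
    simp only [Iso.refl_hom, Over.mk_hom, Algebra.algebraMap_self, CommRingCat.ofHom_id, Spec.map_id]
    rfl)⟩

/-- **`#GroupLike k Γ(G) = rk Γ(G)` WHEN `G^D` IS ÉTALE AND `k = k̄`**: `#G^D(k) = rk Γ(G^D)` (★ `natCard_hom_eq_finrank_of_etale`) `= rk Γ(G)`
(★ `finrank_alg_cartierDual`). [cite: Tate1997FiniteFlatGroupSchemes, (3.7)] -/
theorem natCard_groupLike_eq_finrank [IsAlgClosed k] [Etale (cartierDual G).hom] :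
    Nat.card (GroupLike k (Alg G)) = Module.finrank k (Alg G) := by
  obtain ⟨e⟩ := nonempty_iso_specOver_self_tensorUnit (k := k)
  rw [natCard_groupLike_eq_natCard_hom_cartierDual, Nat.card_congr (e.homCongr (Iso.refl (cartierDual G))), ← finrank_alg_cartierDual G]
  exact natCard_hom_eq_finrank_of_etale (G := cartierDual G)

/-! ## §2 `G^D` étale ⇒ `Γ(G)` has a basis of group-like elements -/

/-- **`G^D` ÉTALE OVER `k = k̄` ⇒ THE GROUP-LIKE ELEMENTS SPAN `Γ(G)`** (linearly independent and `rk Γ(G)` in number). [cite: Demazure1972, Ch. II §8]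
[cite: Tate1997FiniteFlatGroupSchemes, (3.7)] -/
theorem span_isGroupLikeElem_eq_top_of_etale_cartierDual [IsAlgClosed k] [Etale (cartierDual G).hom] :
    Submodule.span k {g : Alg G | IsGroupLikeElem k g} = ⊤ := by
  haveI := finite_groupLike G
  letI := Fintype.ofFinite (GroupLike k (Alg G))
  have hrange : Set.range (GroupLike.val : GroupLike k (Alg G) → Alg G) = {g : Alg G | IsGroupLikeElem k g} :=
    Set.ext fun a => ⟨fun ⟨g, hg⟩ => hg ▸ g.isGroupLikeElem_val, fun ha => ⟨⟨a, ha⟩, rfl⟩⟩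
  rw [← hrange]
  exact (linearIndep_groupLikeVal (R := k) (A := Alg G)).span_eq_top_of_card_eq_finrank'
    ((Nat.card_eq_fintype_card).symm.trans (natCard_groupLike_eq_finrank G))

/-- **`G` IS DIAGONALIZABLE: `Γ(G)` has a `k`-basis consisting of its group-like elements** (indexed by `GroupLike k Γ(G) ≃ G^D(k)`) — the honest content
of «a finite commutative group scheme over `k = k̄` with étale Cartier dual is `D(M)`, the dual of the constant group `M = G^D(k)`».
[cite: Demazure1972, Ch. II §8] [cite: Tate1997FiniteFlatGroupSchemes, (3.7)] -/
theorem exists_basis_groupLike_of_etale_cartierDual [IsAlgClosed k] [Etale (cartierDual G).hom] :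
    ∃ b : Module.Basis (GroupLike k (Alg G)) k (Alg G), ∀ g, b g = g.val := by
  have hrange : Set.range (GroupLike.val : GroupLike k (Alg G) → Alg G) = {g : Alg G | IsGroupLikeElem k g} :=
    Set.ext fun a => ⟨fun ⟨g, hg⟩ => hg ▸ g.isGroupLikeElem_val, fun ha => ⟨⟨a, ha⟩, rfl⟩⟩
  have hspan : ⊤ ≤ Submodule.span k (Set.range (GroupLike.val : GroupLike k (Alg G) → Alg G)) := by
    rw [hrange, span_isGroupLikeElem_eq_top_of_etale_cartierDual G]
  exact ⟨Module.Basis.mk (linearIndep_groupLikeVal (R := k) (A := Alg G)) hspan, fun g => Module.Basis.mk_apply _ _ g⟩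

end AffineGroupScheme

/-! ## §3 HEAD: multiplicative (étale dual) + killed by `p^t` ⇒ killed by `F^t` -/

open Literature.AlgebraicGeometry.Motives AffineGroupScheme

variable {k : Type u} [Field k] [IsAlgClosed k] (p : ℕ) [ExpChar k p] (t : ℕ)

set_option backward.isDefEq.respectTransparency false in
set_option synthInstance.maxHeartbeats 200000 in
-- `1 : G ⟶ G^{(p^t)}` on the transported group object (as in ★ `DiagonalizableKilledByFrobenius` §3)
/-- **A FINITE COMMUTATIVE GROUP SCHEME WITH ÉTALE CARTIER DUAL (MULTIPLICATIVE TYPE, `k = k̄`) KILLED BY `p^t` IS KILLED BY `F^t_{G∕k}`**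
(§2 + ★ `relFrobeniusOver_eq_one_of_span_isGroupLikeElem_of_id_pow_eq_one`) — the `w`-block input «`A₀[𝔭_w^{d_w}] ⊆ A₀[F_q]`» of HEART-FROB §B in organ form.
[cite: Demazure1972, Ch. III §6] [cite: SGA3I, VII_A 4.1] [cite: Tate1997FiniteFlatGroupSchemes, (3.7)] -/
theorem relFrobeniusOver_eq_one_of_etale_cartierDual_of_id_pow_eq_one (G : SchemeOver k) [GrpObj G] [IsCommMonObj G] [IsAffine G.left]
    [Module.Finite k (Alg G)] [Etale (cartierDual G).hom] (hq : (𝟙 G) ^ p ^ t = 1) : relFrobeniusOver p t G = 1 :=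
  relFrobeniusOver_eq_one_of_span_isGroupLikeElem_of_id_pow_eq_one p t G (span_isGroupLikeElem_eq_top_of_etale_cartierDual G) hq

set_option backward.isDefEq.respectTransparency false in
set_option synthInstance.maxHeartbeats 200000 in
-- same
/-- The same for a unit-preserving `c : H → G` from a multiplicative `H` killed by `p^t` into ANY `k`-group scheme `G`: `c ≫ F^t_{G∕k} = 1` (e.g. the
inclusion of a multiplicative closed subgroup of an abelian variety's `p^t`-torsion). [cite: Demazure1972, Ch. III §6] [cite: Tate1997FiniteFlatGroupSchemes, (3.7)] -/
theorem comp_relFrobeniusOver_eq_one_of_etale_cartierDual_of_id_pow_eq_one {H : SchemeOver k} [GrpObj H] [IsCommMonObj H] [IsAffine H.left]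
    [Module.Finite k (Alg H)] [Etale (cartierDual H).hom] (G : SchemeOver k) [GrpObj G] (c : H ⟶ G) (hc : η[H] ≫ c = η[G])
    (hq : (𝟙 H) ^ p ^ t = 1) : c ≫ relFrobeniusOver p t G = 1 :=
  comp_relFrobeniusOver_eq_one_of_span_isGroupLikeElem_of_id_pow_eq_one p t G c hc (span_isGroupLikeElem_eq_top_of_etale_cartierDual H) hq

end Literature.AlgebraicGeometry.GroupSchemes

end
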